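import Summits.Ventures.PercRepro.Night4T3C3Q6M0Z
import Summits.Ventures.PercRepro.Night4T3C4Q6M0Z
import Summits.Ventures.PercRepro.Night4T3C5Q6M0Z
import Summits.Ventures.PercRepro.Night4T3C6Q6M0Z
import Summits.Ventures.PercRepro.Night4T3C7Q6M0Z
import Summits.Ventures.PercRepro.Night4T3C8Q6M0Z
import Summits.Ventures.PercRepro.Night4T3C9Q6M0Z
import Summits.Ventures.PercRepro.Night4T3C10Q6M0Z
import Summits.Ventures.PercRepro.Night4T3C11Q6M0Z
import Summits.Ventures.PercRepro.Night4T3C12Q6M0Z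
import Summits.Ventures.PercRepro.Night4T3C13Q6M0Z
import Summits.Ventures.PercRepro.Night4T3C14Q6M0Z
import Summits.Ventures.PercRepro.Night4T3C15Q6M0Z
import Summits.Ventures.PercRepro.GenQEightSixBounds
import Summits.Ventures.PercRepro.GenQLargeCorankNumB

/-!
# PercRepro — the `(8, 6)` cell: the type-`3` layer of level `6` (night-4, gen 4)
`jq_t3_nonneg_six_of_hyps` assembles the dual certificates `jq_t3_nonneg_c{d}_q6_m0` (coranks `3 … 15`; coranks `≥ 16` by THEOREM LARGE `jq_nonneg_of_large`) with the demand-free coranks `≤ 2` (`Jq_nonneg_of_card_le`); `jq_t3_nonneg_six_of_core_of_ten` instantiates it on a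
Core matroid with `f(4) ≤ 10` (`coreHyps_of_core`, `card_le_fortythree_of_core_of_ten`).
-/
namespace PercRepro.Night4

open Finset ThmH SixFour GenQ PerFlat Star NightThree

variable {α : Type} [DecidableEq α] {M : Matroid α} [M.Finite]

/-- **The type-`3` balance on every coloop-free rank-`6` set with `≤ 43` points** of a matroid with the five
hypotheses of the core: corank `≤ 2` is demand-free, every other corank a dual certificate. -/
theorem jq_t3_nonneg_six_of_hyps (hh : CoreHyps M) {G : Finset α} (hG : G ⊆ gr M)
    (hrG : M.eRk (G : Set α) = ((6 : ℕ) : ℕ∞)) (hmG : mTr M G = 0) (h43 : G.card ≤ 43) : 0 ≤ Jq M G 6 3 := by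
  have hh' := hh
  obtain ⟨hs, hline, hplane, hsolid, hflat5⟩ := hh
  have h6 : 6 ≤ G.card := le_card_of_eRk_eq hrG
  obtain ⟨d, hd⟩ : ∃ d, G.card = 6 + d := ⟨G.card - 6, by omega⟩
  have hd37 : d ≤ 37 := by omega
  interval_cases d
  · exact Jq_nonneg_of_card_le (by norm_num) (by omega)
  · exact Jq_nonneg_of_card_le (by norm_num) (by omega)
  · exact Jq_nonneg_of_card_le (by norm_num) (by omega)
  · exact jq_t3_nonneg_c3_q6_m0 hs hline hplane hsolid hflat5 hG hrG hd hmG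
  · exact jq_t3_nonneg_c4_q6_m0 hs hline hplane hsolid hflat5 hG hrG hd hmG
  · exact jq_t3_nonneg_c5_q6_m0 hs hline hplane hsolid hflat5 hG hrG hd hmG
  · exact jq_t3_nonneg_c6_q6_m0 hs hline hplane hsolid hflat5 hG hrG hd hmG
  · exact jq_t3_nonneg_c7_q6_m0 hs hline hplane hsolid hflat5 hG hrG hd hmG
  · exact jq_t3_nonneg_c8_q6_m0 hs hline hplane hsolid hflat5 hG hrG hd hmG
  · exact jq_t3_nonneg_c9_q6_m0 hs hline hplane hsolid hflat5 hG hrG hd hmG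
  · exact jq_t3_nonneg_c10_q6_m0 hs hline hplane hsolid hflat5 hG hrG hd hmG
  · exact jq_t3_nonneg_c11_q6_m0 hs hline hplane hsolid hflat5 hG hrG hd hmG
  · exact jq_t3_nonneg_c12_q6_m0 hs hline hplane hsolid hflat5 hG hrG hd hmG
  · exact jq_t3_nonneg_c13_q6_m0 hs hline hplane hsolid hflat5 hG hrG hd hmG
  · exact jq_t3_nonneg_c14_q6_m0 hs hline hplane hsolid hflat5 hG hrG hd hmG
  · exact jq_t3_nonneg_c15_q6_m0 hs hline hplane hsolid hflat5 hG hrG hd hmG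
  · exact jq_nonneg_of_large' hh' hG hrG (by norm_num) (by norm_num) (by omega) (by omega)
  · exact jq_nonneg_of_large' hh' hG hrG (by norm_num) (by norm_num) (by omega) (by omega)
  · exact jq_nonneg_of_large' hh' hG hrG (by norm_num) (by norm_num) (by omega) (by omega)
  · exact jq_nonneg_of_large' hh' hG hrG (by norm_num) (by norm_num) (by omega) (by omega)
  · exact jq_nonneg_of_large' hh' hG hrG (by norm_num) (by norm_num) (by omega) (by omega)
  · exact jq_nonneg_of_large' hh' hG hrG (by norm_num) (by norm_num) (by omega) (by omega)
  · exact jq_nonneg_of_large' hh' hG hrG (by norm_num) (by norm_num) (by omega) (by omega)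
  · exact jq_nonneg_of_large' hh' hG hrG (by norm_num) (by norm_num) (by omega) (by omega)
  · exact jq_nonneg_of_large' hh' hG hrG (by norm_num) (by norm_num) (by omega) (by omega)
  · exact jq_nonneg_of_large' hh' hG hrG (by norm_num) (by norm_num) (by omega) (by omega)
  · exact jq_nonneg_of_large' hh' hG hrG (by norm_num) (by norm_num) (by omega) (by omega)
  · exact jq_nonneg_of_large' hh' hG hrG (by norm_num) (by norm_num) (by omega) (by omega)
  · exact jq_nonneg_of_large' hh' hG hrG (by norm_num) (by norm_num) (by omega) (by omega)
  · exact jq_nonneg_of_large' hh' hG hrG (by norm_num) (by norm_num) (by omega) (by omega)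
  · exact jq_nonneg_of_large' hh' hG hrG (by norm_num) (by norm_num) (by omega) (by omega)
  · exact jq_nonneg_of_large' hh' hG hrG (by norm_num) (by norm_num) (by omega) (by omega)
  · exact jq_nonneg_of_large' hh' hG hrG (by norm_num) (by norm_num) (by omega) (by omega)
  · exact jq_nonneg_of_large' hh' hG hrG (by norm_num) (by norm_num) (by omega) (by omega)
  · exact jq_nonneg_of_large' hh' hG hrG (by norm_num) (by norm_num) (by omega) (by omega)
  · exact jq_nonneg_of_large' hh' hG hrG (by norm_num) (by norm_num) (by omega) (by omega)
  · exact jq_nonneg_of_large' hh' hG hrG (by norm_num) (by norm_num) (by omega) (by omega)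
  · exact jq_nonneg_of_large' hh' hG hrG (by norm_num) (by norm_num) (by omega) (by omega)

/-- **The type-`3` balance on the coloop-free rank-`6` flats of a Core matroid** from the named input `f(4) ≤ 10`. -/
theorem jq_t3_nonneg_six_of_core_of_ten {p : ℕ} (hc : Core M p) (h10 : ∀ F ∈ flatsQ M 4, F.card ≤ 10)
    {G : Finset α} (hG : G ∈ flatsQ M 6) (hmG : mTr M G = 0) : 0 ≤ Jq M G 6 3 := by
  have hG' := mem_flatsQ.1 hG
  exact jq_t3_nonneg_six_of_hyps (coreHyps_of_core hc h10) hG'.1 hG'.2.2 hmG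
    (card_le_fortythree_of_core_of_ten hc h10 hG)

end PercRepro.Night4
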